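import Literature.NumberTheory.Sieve.GoldbachLinnikRomanovCertDefs
import Literature.NumberTheory.Sieve.GoldbachLinnikRomanovCertData1
import Literature.NumberTheory.Sieve.GoldbachLinnikRomanovCertData2

/-!
# Romanov certificate — head sums 5/7

Kernel evaluation (`decide +kernel`) of the checker of `GoldbachLinnikRomanovCertDefs.lean` on the records
`parseRecs 20000 (digitsOf (fsegs1 ++ fsegs2))` of `GoldbachLinnikRomanovCertData1/2.lean`; soundness: `GoldbachLinnikRomanovCertSound1.lean`,
`GoldbachLinnikRomanovCertTop.lean`. [folklore]
-/

namespace Literature.NumberTheory.Sieve.RomanovCert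

set_option maxHeartbeats 0 in
/-- The head accumulators `(T⁺, T⁻, I, S⁺, S⁻, ok)` on `d ∈ [8192, 12288)`. [folklore] -/
theorem head_8192 : headSums (parseRecs 20000 (digitsOf (fsegs1 ++ fsegs2))) 8192 4096 = (905293384354091974, 666830332857745626, 150591334985686, 9144541566023955048807, 15243480699851585029315, true) := by
  decide +kernel

set_option maxHeartbeats 0 in
/-- The head accumulators `(T⁺, T⁻, I, S⁺, S⁻, ok)` on `d ∈ [12288, 16384)`. [folklore] -/
theorem head_12288 : headSums (parseRecs 20000 (digitsOf (fsegs1 ++ fsegs2))) 12288 4096 = (642480880524540555, 321240440262267221, 138275345371395, 9147152477855951321411, 9147152477855951325101, true) := by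
  decide +kernel

end Literature.NumberTheory.Sieve.RomanovCert
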